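import Summits.CriticalPhenomena.PercolationContinuityZ3.Theorems.PercNearOneGluingNoHeavyQuantBandTwoBlobCells
import Summits.CriticalPhenomena.PercolationContinuityZ3.Theorems.PercNearOneGluingNoHeavyQuantLightTwoBlobDEC
import HarnessLib

/-!
# QUANT lane R8, T-DEC: the BAND PIECE of SL-λ* — part 4: **`LawDec.bandTwoBlobDEC_holds : BandTwoBlobDEC`** (census-1 g19 SLAMSTAR-G19 §2
# is a kernel theorem)

builds on p205010 (kernel theorem, internal audit signed; external expert review pending)

Support file (`--supports stmt-CriticalPhenomena-4575`), QUANT lane typer seat prim-quant-stmt (gen 24), rung R8 of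
`run/shared/lean/prim/quant/LADDER.md`.  Theorems only, standard axioms, no sorries.  Parts 1–3: `…QuantBandTwoBlobFlow` (typed statement, flow
reduction `twoBlob_decAtT_of_bandFlow`), `…QuantBandTwoBlobPoly` (certificates), `…QuantBandTwoBlobCells` (`giant_C*`, `band_numerics_L/H`).

* `bandTwoBlob_decAtT_straddle` — `DECAtT x (bκ + ag) j″ (b + a) LAW2[b, x² + (1−x)κ; a, g]` for `a ≤ j″ < b + a` (`0 < κ < x ≤ g ≤ 1`,
  `2b ≤ bκ + ag`): the flow theorem with the numerics, the usage rates put in closed form by `usage_eq_light'/heavy'`, `usage0_eq_heavy`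
  (typer g23); when `2b = T` the atom `b` is self-sufficient and `F₁ := 0` (the giant inequality only improves);
* **`bandTwoBlobDEC_holds : BandTwoBlobDEC`** — straddling layers by the above, layers `≥ a + b` by `lightTwoBlobDEC_holds` (typer g23).

CONSEQUENCE (census-1 g19 §2 (d), README V264 step 3): every component of the canonical (corner) flow of a DEC datum into a column `≤ λ*` is
LOCALLY sliceable — below (`lightTwoBlobDEC_holds`) / heavy (`slice_heavyPair_decAtT`) / far (`slice_farPair_decAtT`) / band (this file) —, so
the reduction of SL-λ* to pure window laws (Theorem A / A⁺ / B / C world) needs no pooling across pieces.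

[this work]; DEC rules ARCH-TREES-G49 §2.2 / DEC-TAMP-G50 §3.1, flow normal form `…QuantLawDecFlows` (this lane).  Nothing here is cited as a
published result.  The gluing rows served [cite: KozmaNitzan2024, Conjecture 3 (p. 15)]; product measure [cite: Grimmett1999, §1.3 p. 10].
-/

noncomputable section

namespace Summit.CriticalPhenomena.PercolationContinuityZ3.Theorems

namespace Quant

open Finset

/-- the two-blob law `(1−u)(1−v)δ₀ + u(1−v)δ_a + (1−u)vδ_b + uvδ_{a+b}` evaluated at `h` (as in `…QuantBlobDecTwoLawParts`) -/
local notation3 "LAW2[" a ", " u ", " b ", " v ", " h "]" =>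
  (1 - (u : ℝ)) * (1 - (v : ℝ)) * (if (h : ℕ) = 0 then (1 : ℝ) else 0)
    + (u : ℝ) * (1 - (v : ℝ)) * (if (h : ℕ) = (a : ℕ) then (1 : ℝ) else 0)
    + (1 - (u : ℝ)) * (v : ℝ) * (if (h : ℕ) = (b : ℕ) then (1 : ℝ) else 0)
    + (u : ℝ) * (v : ℝ) * (if (h : ℕ) = (a : ℕ) + (b : ℕ) then (1 : ℝ) else 0)

namespace LawDec

/-! ### The theorem -/

/-- **THE BAND PIECE AT A STRADDLING LAYER** (`a ≤ j″ < b + a`), in the `κ`-parametrisation: for `0 < x < 1`, `0 < κ < x`, `x ≤ g ≤ 1`,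
`1 ≤ b`, `2b ≤ bκ + ag`: `DECAtT x (bκ + ag) j″ (b + a) LAW2[b, x² + (1−x)κ; a, g]`. [this work] -/
theorem bandTwoBlob_decAtT_straddle (x κ g : ℝ) (a b j'' : ℕ) (hx0 : 0 < x) (hx1 : x < 1) (hk0 : 0 < κ) (hkx : κ < x)
    (hxg : x ≤ g) (hg1 : g ≤ 1) (hb : 1 ≤ b) (hja : a ≤ j'') (hj : j'' < b + a)
    (hband : 2 * (b : ℝ) ≤ (b : ℝ) * κ + (a : ℝ) * g) :
    DECAtT x ((b : ℝ) * κ + (a : ℝ) * g) j'' (b + a) (fun h => LAW2[b, x ^ 2 + (1 - x) * κ, a, g, h]) := by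
  have h1x : 0 < 1 - x := sub_pos.2 hx1
  have hb0 : (0 : ℝ) < b := by exact_mod_cast Nat.lt_of_lt_of_le Nat.zero_lt_one hb
  have hg0 : 0 < g := hx0.trans_le hxg
  have hgam : 0 < x ^ 2 + (1 - x) * κ := by nlinarith [mul_pos h1x hk0, pow_pos hx0 2]
  have hgam1 : x ^ 2 + (1 - x) * κ < 1 := by nlinarith [mul_lt_mul_of_pos_left hkx h1x]
  -- `b < a` (the band condition with `κ < 1`, `g ≤ 1`)
  have hab' : (b : ℝ) < a := by
    by_contra hn
    push Not at hn
    have ha0 : (0 : ℝ) ≤ a := Nat.cast_nonneg a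
    nlinarith [mul_nonneg ha0 (sub_nonneg.2 hg1), mul_pos hb0 (sub_pos.2 (hkx.trans hx1))]
  have hab : b < a := by exact_mod_cast hab'
  have ha0 : (0 : ℝ) < a := hb0.trans hab'
  set T : ℝ := (b : ℝ) * κ + (a : ℝ) * g with hT
  have hT0 : 0 < T := by nlinarith [mul_pos hb0 hk0, mul_pos ha0 hg0]
  have hsT : T < (a : ℝ) + b := by nlinarith [mul_pos hb0 (sub_pos.2 (hkx.trans hx1)), mul_nonneg ha0.le (sub_nonneg.2 hg1)]
  have hT2a : T ≤ 2 * (a : ℝ) := by linarith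
  -- the numerics (light or heavy side of the pair `(b, a)`), with the usage rates in closed form
  have main : ∃ F₁ F₂ : ℝ, 0 ≤ F₁ ∧ F₁ ≤ (x ^ 2 + (1 - x) * κ) * (1 - g) ∧ 0 ≤ F₂ ∧ F₂ ≤ (1 - (x ^ 2 + (1 - x) * κ)) * (1 - g) ∧
      (0 < F₂ → T < a) ∧ (2 * (b : ℝ) < T → usage x T j'' b a * F₁ + usage x T j'' 0 a * F₂ ≤ (1 - (x ^ 2 + (1 - x) * κ)) * g) ∧
      (usage x T j'' 0 a * F₂ ≤ (1 - (x ^ 2 + (1 - x) * κ)) * g) ∧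
      x / (1 - x) * (((x ^ 2 + (1 - x) * κ) * (1 - g) - F₁) + ((1 - (x ^ 2 + (1 - x) * κ)) * (1 - g) - F₂))
        ≤ (x ^ 2 + (1 - x) * κ) * g := by
    -- the rate of the pair `(0, a)` (heavy: `x·a ≤ ag ≤ T`), needed only when `F₂ > 0`
    have hu2 : ∀ F₂ : ℝ, 0 ≤ F₂ → (0 < F₂ → T < a) →
        usage x T j'' 0 a * F₂ = T / ((a : ℝ) - T) * F₂ := by
      intro F₂ hF2 hF2c
      rcases hF2.eq_or_lt with hz | hpos
      · rw [← hz, mul_zero, mul_zero]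
      · rw [usage0_eq_heavy x T j'' a hx0 hx1 hja hT0 (hF2c hpos) (by rw [hT]; nlinarith [mul_nonneg ha0.le (sub_nonneg.2 hxg)])]
    by_cases hside : T - 2 * (b : ℝ) ≤ x * ((a : ℝ) - b)
    · obtain ⟨F₁, F₂, hF1, hF1', hF2, hF2', hF2c, hmid, htop⟩ :=
        band_numerics_L x κ g a b hx0 hx1 hk0 hkx hxg hg1 hb0 hab' hband hside
      have hu1F2 := hu2 F₂ hF2 hF2c
      have hu1pos : 0 ≤ (x ^ 2 * ((a : ℝ) - b) + (1 - x) * (T - 2 * b)) / ((1 - x) * ((1 - x) * b + (1 + x) * a - T)) * F₁ :=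
        mul_nonneg (div_nonneg (by nlinarith [mul_pos (pow_pos hx0 2) (sub_pos.2 hab')])
          (mul_nonneg h1x.le (by nlinarith [mul_pos hx0 (sub_pos.2 hab')]))) hF1
      refine ⟨F₁, F₂, hF1, hF1', hF2, hF2', hF2c, fun hlow => ?_, ?_, htop⟩
      · rw [usage_eq_light' x T j'' b a hx0 hx1 hja hlow (by linarith) hside, hu1F2]; exact hmid
      · rw [hu1F2]; linarith [hmid]
    · push Not at hside
      obtain ⟨F₁, F₂, hF1, hF1', hF2, hF2', hF2c, hmid, htop⟩ :=
        band_numerics_H x κ g a b hx0 hx1 hk0 hkx hxg hg1 hb0 hab' hband hside.le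
      have hu1F2 := hu2 F₂ hF2 hF2c
      have hu1pos : 0 ≤ (T - 2 * (b : ℝ)) / ((b : ℝ) + a - T) * F₁ :=
        mul_nonneg (div_nonneg (by linarith) (by linarith)) hF1
      refine ⟨F₁, F₂, hF1, hF1', hF2, hF2', hF2c, fun hlow => ?_, ?_, htop⟩
      · rw [usage_eq_heavy' x T j'' b a hx0 hx1 hja hlow (by linarith) hside.le, hu1F2]; exact hmid
      · rw [hu1F2]; linarith [hmid]
  obtain ⟨F₁, F₂, hF1, hF1', hF2, hF2', hF2c, hmid, hmid0, htop⟩ := main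
  by_cases hlow : 2 * (b : ℝ) < T
  · exact twoBlob_decAtT_of_bandFlow x (x ^ 2 + (1 - x) * κ) g T F₁ F₂ a b j'' hx0 hx1 hgam.le hgam1.le hg0.le hg1 hb hab hja hj
      hband hT2a hsT hF1 hF1' (fun _ => hlow) hF2 hF2' hF2c (hmid hlow) (by rw [if_pos hlow]; exact htop)
  · -- `2b = T`: the atom `b` is self-sufficient, nothing of it is shipped
    refine twoBlob_decAtT_of_bandFlow x (x ^ 2 + (1 - x) * κ) g T 0 F₂ a b j'' hx0 hx1 hgam.le hgam1.le hg0.le hg1 hb hab hja hj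
      hband hT2a hsT le_rfl (mul_nonneg hgam.le (by linarith)) (fun h => absurd h (lt_irrefl 0)) hF2 hF2' hF2c
      (by rw [mul_zero, zero_add]; exact hmid0) ?_
    rw [if_neg hlow, zero_add]
    have hxx : 0 ≤ x / (1 - x) := (div_pos hx0 h1x).le
    have hrest : 0 ≤ (x ^ 2 + (1 - x) * κ) * (1 - g) - F₁ := sub_nonneg.2 hF1'
    nlinarith [mul_nonneg hxx hrest]

/-- **THE BAND PIECE IS A THEOREM** (census-1 g19, SLAMSTAR-G19 §2): `LawDec.BandTwoBlobDEC` holds — straddling layers `a ≤ j″ < a + b` by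
`bandTwoBlob_decAtT_straddle`, layers `j″ ≥ a + b` by typer g23's `lightTwoBlobDEC_holds`. [this work] -/
theorem bandTwoBlobDEC_holds : BandTwoBlobDEC := by
  intro x γ g a b j'' hx0 hx1 hγ0 hγx hxg hg1 ha hb hja hband
  by_cases hj : a + b ≤ j''
  · exact lightTwoBlobDEC_holds x γ g a b j'' hx0 hx1 hγ0 hγx hxg hg1 ha hb hj
  · push Not at hj
    have h1x : 0 < 1 - x := sub_pos.2 hx1
    set κ := (γ - x ^ 2) / (1 - x) with hκ
    have hk0 : 0 < κ := div_pos (by linarith) h1x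
    have hkx : κ < x := by rw [hκ, div_lt_iff₀ h1x]; nlinarith
    have hγ : γ = x ^ 2 + (1 - x) * κ := by rw [hκ]; field_simp; ring
    have hband' : 2 * (b : ℝ) ≤ (b : ℝ) * κ + (a : ℝ) * g := by
      have : (b : ℝ) * (2 - κ) ≤ (a : ℝ) * g := hband
      linarith
    have h := bandTwoBlob_decAtT_straddle x κ g a b j'' hx0 hx1 hk0 hkx hxg hg1 hb hja (by omega) hband'
    rw [hγ]
    exact h

end LawDec

end Quant

end Summit.CriticalPhenomena.PercolationContinuityZ3.Theorems
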